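import Mathlib

/-!
# Discrete rigidity and `ℤ`-torsors ([EtTh] §2, Proposition 2.15)

Mochizuki, *The Étale Theta Function …*, Publ. RIMS 45 (2009) [EtTh], Proposition 2.15
"Discrete Rigidity and `ℤ`-torsors", PRIMS text pp.52–53 (locators = PDF pages, bib key
`MochizukiEtTh2009`). Everything in this file is elementary and PROVED.

* `TObj`, the category `𝒯` whose objects `T_M` (`M ∈ ℕ≥1`) are copies of `ℤ` (thought of as
  `ℤ`-torsors) and whose morphisms `T_{M'} → T_M` (for `M ∣ M'`) are the translations by elements
  of `M·ℤ` (p.52).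
* `ESystem E idx` — an `E`-system `{S_M; β_{M',M}}` of `𝒯` with `S_M = T_{idx M}`, for
  `E ⊆ ℕ≥1` with `1 ∈ E` (the text also assumes `E` cofinal and totally ordered for divisibility;
  each result below records exactly the part of that hypothesis it uses); `ESystem.Iso`.
* Prop 2.15 (i) `aut_shift_mem` / `autShiftEquiv` / `comm_iff_shift_eq`; (ii) `iso_of_idx_one`;
  (iii) `jSeq`, `jSeq_compatible` (convergence in `lim_{M ∈ E} ℤ/Mℤ`, which is `Ẑ` for cofinal
  `E`), `jSeq_surjective`, `jSeq_iso_invariant` (the image in `Ẑ/ℤ` is an isomorphism invariant);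
  (iv) `exists_nonisomorphic` (for cofinal `E`).

Remark 2.15.1 (generalisation to categories equivalent to `𝒯`) and Remark 2.15.2 (temperoids)
are not formalised here.
-/

namespace Literature.AnabelianGeometry.EtaleTheta

open CategoryTheory

/-- The objects `T_M`, `M ∈ ℕ≥1`, of the category `𝒯` of Prop 2.15: copies of `ℤ` "which we think
of as torsors over `ℤ`". [cite: MochizukiEtTh2009, Prop 2.15 p.52] -/
structure TObj : Type where
  /-- the index `M ∈ ℕ≥1` of the object `T_M` -/
  idx : ℕ+

namespace TObj

/-- A morphism `T_{M'} → T_M` of `𝒯` (defined only when `M ∣ M'`): the composite of the "identity"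
`T_{M'} = ℤ → ℤ = T_M` with the translation by an element `shift ∈ M·ℤ`.
[cite: MochizukiEtTh2009, Prop 2.15 p.52] -/
@[ext]
structure Hom (A B : TObj) : Type where
  /-- the translation amount, an element of `B.idx · ℤ` -/
  shift : ℤ
  /-- morphisms `T_{M'} → T_M` exist only for `M ∣ M'` -/
  dvd : (B.idx : ℤ) ∣ (A.idx : ℤ)
  /-- the translation is by an element of `M·ℤ` -/
  mem : (B.idx : ℤ) ∣ shift

/-- `𝒯` is a category (composition = composition of translations).
[cite: MochizukiEtTh2009, Prop 2.15 p.52] -/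
instance : Category TObj where
  Hom := Hom
  id A := ⟨0, dvd_rfl, dvd_zero _⟩
  comp f g := ⟨f.shift + g.shift, g.dvd.trans f.dvd, dvd_add (g.dvd.trans f.mem) g.mem⟩
  id_comp f := by apply Hom.ext; change 0 + f.shift = f.shift; ring
  comp_id f := by apply Hom.ext; change f.shift + 0 = f.shift; ring
  assoc f g h := by apply Hom.ext; change f.shift + g.shift + h.shift = _; exact add_assoc _ _ _

/-- Extensionality for morphisms of `𝒯`. [cite: MochizukiEtTh2009, Prop 2.15 p.52] -/
@[ext] theorem hom_ext {A B : TObj} {f g : A ⟶ B} (h : f.shift = g.shift) : f = g := Hom.ext h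

/-- Shift of the identity. [cite: MochizukiEtTh2009, Prop 2.15 p.52] -/
@[simp] theorem id_shift (A : TObj) : (𝟙 A : A ⟶ A).shift = 0 := rfl

/-- Shift of a composite. [cite: MochizukiEtTh2009, Prop 2.15 p.52] -/
@[simp] theorem comp_shift {A B C : TObj} (f : A ⟶ B) (g : B ⟶ C) :
    (f ≫ g).shift = f.shift + g.shift := rfl

/-- The underlying map of sets `ℤ → ℤ` of a morphism of `𝒯` (a translation).
[cite: MochizukiEtTh2009, Prop 2.15 p.52] -/
def Hom.toFun {A B : TObj} (f : A ⟶ B) : ℤ → ℤ := fun x => x + f.shift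

/-- **Proposition 2.15 (i)** (Groups of Automorphisms), first part: an automorphism of `T_M`
translates by an element of `M·ℤ`. [cite: MochizukiEtTh2009, Prop 2.15(i) p.52] -/
theorem aut_shift_mem (A : TObj) (f : Aut A) : (A.idx : ℤ) ∣ f.hom.shift := f.hom.mem

/-- **Proposition 2.15 (i)**: the natural isomorphism `Aut_𝒯(T_M) ≃ M·ℤ`, `f ↦ shift(f)`
(a bijection turning composition into addition, cf. `comp_shift`).
[cite: MochizukiEtTh2009, Prop 2.15(i) p.52] -/
def autShiftEquiv (A : TObj) : Aut A ≃ {k : ℤ // (A.idx : ℤ) ∣ k} where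
  toFun f := ⟨f.hom.shift, f.hom.mem⟩
  invFun k := ⟨⟨k.1, dvd_rfl, k.2⟩, ⟨-k.1, dvd_rfl, (dvd_neg).mpr k.2⟩,
    by ext; simp, by ext; simp⟩
  left_inv f := by
    apply Iso.ext; ext; rfl
  right_inv k := by simp

/-- **Proposition 2.15 (i)**, second part: for a morphism `φ : T_{M'} → T_M`, automorphisms
`a` of `T_{M'}` and `a'` of `T_M` are `φ`-compatible iff they have the same shift; thus `φ`
induces the injection `Aut(T_{M'}) = M'·ℤ ↪ M·ℤ = Aut(T_M)` given by the inclusion `M'·ℤ ⊆ M·ℤ`.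
[cite: MochizukiEtTh2009, Prop 2.15(i) p.52] -/
theorem comm_iff_shift_eq {A B : TObj} (φ : A ⟶ B) (a : A ⟶ A) (a' : B ⟶ B) :
    a ≫ φ = φ ≫ a' ↔ a.shift = a'.shift := by
  constructor
  · intro h
    have := congrArg Hom.shift h
    simp only [comp_shift] at this
    linarith
  · intro h; ext; simp [h, add_comm]

/-- The inclusion `M'·ℤ ⊆ M·ℤ` for `M ∣ M'` realised on automorphism groups (Prop 2.15 (i)).
[cite: MochizukiEtTh2009, Prop 2.15(i) p.52] -/
def autRestrict {A B : TObj} (φ : A ⟶ B) (a : Aut A) : Aut B :=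
  (autShiftEquiv B).symm ⟨a.hom.shift, φ.dvd.trans a.hom.mem⟩

/-- The restricted automorphism is the unique `φ`-compatible one.
[cite: MochizukiEtTh2009, Prop 2.15(i) p.52] -/
theorem autRestrict_comm {A B : TObj} (φ : A ⟶ B) (a : Aut A) :
    a.hom ≫ φ = φ ≫ (autRestrict φ a).hom :=
  (comm_iff_shift_eq φ _ _).mpr rfl

end TObj

/-! ## `E`-systems -/

/-- An **`E`-system** `{S_M; β_{M',M}}_{M,M' ∈ E}` of `𝒯` (Prop 2.15): a projective system of
objects `S_M = T_{idx M}` and morphisms `β_{M',M} : S_{M'} → S_M` (`M ∣ M'`) of `𝒯` indexed by a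
subset `E ⊆ ℕ≥1` ordered by divisibility. [cite: MochizukiEtTh2009, Prop 2.15 p.52] -/
structure ESystem (E : Set ℕ+) (idx : ℕ+ → ℕ+) : Type where
  /-- the transition morphism `β_{M',M} : S_{M'} → S_M` for `M ∣ M'` in `E` -/
  β : ∀ M M' : E, (M : ℕ+) ∣ (M' : ℕ+) → (TObj.mk (idx M') ⟶ TObj.mk (idx M))
  /-- `β_{M,M} = id` -/
  β_self : ∀ (M : E) (h : (M : ℕ+) ∣ (M : ℕ+)), β M M h = 𝟙 _
  /-- `β_{M'',M} = β_{M',M} ∘ β_{M'',M'}` -/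
  β_comp : ∀ (M M' M'' : E) (h : (M : ℕ+) ∣ M') (h' : (M' : ℕ+) ∣ M''),
    β M M'' (h.trans h') = β M' M'' h' ≫ β M M' h

namespace ESystem

variable {E : Set ℕ+} {idx : ℕ+ → ℕ+}

/-- An **isomorphism of `E`-systems**: isomorphisms `α_M : S_M ≅ S'_M` of `𝒯` with
`α_M ∘ β_{M',M} = β'_{M',M} ∘ α_{M'}`. [cite: MochizukiEtTh2009, Prop 2.15 p.52] -/
structure Iso (S S' : ESystem E idx) : Type where
  /-- the components `α_M` -/
  α : ∀ M : E, TObj.mk (idx M) ≅ TObj.mk (idx M)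
  /-- compatibility with the transition morphisms -/
  comm : ∀ (M M' : E) (h : (M : ℕ+) ∣ M'), S.β M M' h ≫ (α M).hom = (α M').hom ≫ S'.β M M' h

/-- The shift of a transition map `β_{M',M}` is divisible by `idx M`.
[cite: MochizukiEtTh2009, Prop 2.15 p.52] -/
theorem idx_dvd_shift (S : ESystem E idx) (M M' : E) (h : (M : ℕ+) ∣ M') :
    ((idx M : ℕ) : ℤ) ∣ (S.β M M' h).shift := (S.β M M' h).mem

/-- Shifts of transition maps add up: `shift β_{M'',M} = shift β_{M'',M'} + shift β_{M',M}`.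
[cite: MochizukiEtTh2009, Prop 2.15 p.52] -/
theorem shift_comp (S : ESystem E idx) (M M' M'' : E) (h : (M : ℕ+) ∣ M')
    (h' : (M' : ℕ+) ∣ M'') :
    (S.β M M'' (h.trans h')).shift = (S.β M' M'' h').shift + (S.β M M' h).shift := by
  rw [S.β_comp M M' M'' h h']; rfl

/-! ### Proposition 2.15 (ii): piecewise rigid `E`-systems -/

/-- **Proposition 2.15 (ii)** (Piecewise Rigid `E`-systems): if `1 ∈ E` and `S_M = S'_M = T_1`
for all `M ∈ E`, then any two `E`-systems are isomorphic (take `α_M` = translation by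
`shift β_{M,1} − shift β'_{M,1}`). [cite: MochizukiEtTh2009, Prop 2.15(ii) p.52] -/
def isoOfIdxOne (h1 : (1 : ℕ+) ∈ E) (S S' : ESystem E (fun _ => 1)) : Iso S S' where
  α M :=
    { hom := ⟨(S.β ⟨1, h1⟩ M (one_dvd _)).shift - (S'.β ⟨1, h1⟩ M (one_dvd _)).shift,
        dvd_rfl, by simp⟩
      inv := ⟨(S'.β ⟨1, h1⟩ M (one_dvd _)).shift - (S.β ⟨1, h1⟩ M (one_dvd _)).shift,
        dvd_rfl, by simp⟩
      hom_inv_id := by ext; simp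
      inv_hom_id := by ext; simp }
  comm M M' h := by
    ext
    simp only [TObj.comp_shift]
    have e1 := S.shift_comp ⟨1, h1⟩ M M' (one_dvd _) h
    have e2 := S'.shift_comp ⟨1, h1⟩ M M' (one_dvd _) h
    linarith

/-- **Proposition 2.15 (ii)**, existence form. [cite: MochizukiEtTh2009, Prop 2.15(ii) p.52] -/
theorem iso_of_idx_one (h1 : (1 : ℕ+) ∈ E) (S S' : ESystem E (fun _ => 1)) :
    Nonempty (Iso S S') := ⟨isoOfIdxOne h1 S S'⟩

/-! ### Proposition 2.15 (iii): piecewise non-rigid `E`-systems I -/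

/-- For an `E`-system with `S_M = T_M`: `j^S_M := β_{M,1}(0) ∈ T_1 = ℤ`.
[cite: MochizukiEtTh2009, Prop 2.15(iii) p.52] -/
def jSeq (h1 : (1 : ℕ+) ∈ E) (S : ESystem E id) (M : E) : ℤ :=
  TObj.Hom.toFun (S.β ⟨1, h1⟩ M (one_dvd _)) 0

/-- `j^S_M` is the shift of `β_{M,1}`. [cite: MochizukiEtTh2009, Prop 2.15(iii) p.52] -/
theorem jSeq_eq (h1 : (1 : ℕ+) ∈ E) (S : ESystem E id) (M : E) :
    S.jSeq h1 M = (S.β ⟨1, h1⟩ M (one_dvd _)).shift := by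
  simp [jSeq, TObj.Hom.toFun]

/-- **Proposition 2.15 (iii)**, convergence: the sequence `{j^S_M}_{M ∈ E}` is a compatible family
modulo the `M`'s, i.e. `j_{M'} ≡ j_M (mod M)` for `M ∣ M'` — it converges in
`lim_{M ∈ E} ℤ/Mℤ` (`= Ẑ` for `E` cofinal) to an element `j^S_∞`.
[cite: MochizukiEtTh2009, Prop 2.15(iii) p.52] -/
theorem jSeq_compatible (h1 : (1 : ℕ+) ∈ E) (S : ESystem E id) (M M' : E)
    (h : (M : ℕ+) ∣ M') : ((M : ℕ+) : ℤ) ∣ S.jSeq h1 M' - S.jSeq h1 M := by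
  rw [jSeq_eq, jSeq_eq, S.shift_comp ⟨1, h1⟩ M M' (one_dvd _) h, add_sub_cancel_right]
  exact S.idx_dvd_shift M M' h

/-- The limit `j^S_∞ ∈ lim_{M ∈ E} ℤ/Mℤ` as a compatible family of residues.
[cite: MochizukiEtTh2009, Prop 2.15(iii) p.52] -/
def jLim (h1 : (1 : ℕ+) ∈ E) (S : ESystem E id) (M : E) : ZMod (M : ℕ+) := (S.jSeq h1 M : ℤ)

/-- Compatibility of the residues of `j^S_∞`. [cite: MochizukiEtTh2009, Prop 2.15(iii) p.52] -/
theorem jLim_compatible (h1 : (1 : ℕ+) ∈ E) (S : ESystem E id) (M M' : E)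
    (h : (M : ℕ+) ∣ M') :
    ZMod.castHom (PNat.dvd_iff.mp h) (ZMod (M : ℕ+)) (S.jLim h1 M') = S.jLim h1 M := by
  simp only [jLim, map_intCast]
  rw [ZMod.intCast_eq_intCast_iff_dvd_sub]
  have := S.jSeq_compatible h1 M M' h
  rw [← dvd_neg, neg_sub] at this
  exact_mod_cast this

/-- The `E`-system with `S_M = T_M` built from a sequence of integers `j` with `j_{M'} ≡ j_M (M)`
and `j_1 = 0`: `β_{M',M}` := translation by `j_{M'} − j_M ∈ M·ℤ` (proof of Prop 2.15 (iii)).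
[cite: MochizukiEtTh2009, Prop 2.15(iii) p.53] -/
def ofSeq (j : E → ℤ) (hj : ∀ (M M' : E), (M : ℕ+) ∣ M' → ((M : ℕ+) : ℤ) ∣ j M' - j M) :
    ESystem E id where
  β M M' h := ⟨j M' - j M, by exact_mod_cast PNat.dvd_iff.mp h, hj M M' h⟩
  β_self M h := by ext; simp
  β_comp M M' M'' h h' := by ext; simp

/-- **Proposition 2.15 (iii)**, surjectivity of `S ↦ j^S_∞`: every compatible family of residues
`(x_M)_{M ∈ E}` is the `j_∞` of some `E`-system with `S_M = T_M`.
[cite: MochizukiEtTh2009, Prop 2.15(iii) p.52] -/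
theorem jSeq_surjective (h1 : (1 : ℕ+) ∈ E) (x : ∀ M : E, ZMod (M : ℕ+))
    (hx : ∀ (M M' : E) (h : (M : ℕ+) ∣ M'),
      ZMod.castHom (PNat.dvd_iff.mp h) (ZMod (M : ℕ+)) (x M') = x M) :
    ∃ S : ESystem E id, ∀ M : E, S.jLim h1 M = x M := by
  classical
  -- integer lifts of the residues
  let j : E → ℤ := fun M => ((x M).val : ℤ)
  have hj : ∀ (M M' : E), (M : ℕ+) ∣ M' → ((M : ℕ+) : ℤ) ∣ j M' - j M := by
    intro M M' h
    have hc := hx M M' h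
    rw [ZMod.castHom_apply, ZMod.cast_eq_val] at hc
    rw [← ZMod.intCast_eq_intCast_iff_dvd_sub, Int.cast_natCast, Int.cast_natCast, hc,
      ZMod.natCast_zmod_val]
  refine ⟨ofSeq j hj, fun M => ?_⟩
  have h0 : (x ⟨1, h1⟩).val = 0 := by
    have : (x ⟨1, h1⟩).val < ((1 : ℕ+) : ℕ) := ZMod.val_lt _
    simp only [PNat.one_coe, Nat.lt_one_iff] at this
    exact this
  simp only [jLim, jSeq_eq, ofSeq, j, h0, Nat.cast_zero, sub_zero, Int.cast_natCast,
    ZMod.natCast_zmod_val]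

/-- **Proposition 2.15 (iii)**, invariance: the image of `j^S_∞` in `Ẑ/ℤ` depends only on the
isomorphism class of `S` — isomorphic systems have `j`-sequences differing by an INTEGER constant
modulo every `M`. [cite: MochizukiEtTh2009, Prop 2.15(iii) p.52] -/
theorem jSeq_iso_invariant (h1 : (1 : ℕ+) ∈ E) {S S' : ESystem E id} (e : Iso S S') :
    ∃ n : ℤ, ∀ M : E, ((M : ℕ+) : ℤ) ∣ S'.jSeq h1 M - (S.jSeq h1 M + n) := by
  refine ⟨(e.α ⟨1, h1⟩).hom.shift, fun M => ?_⟩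
  have hc := congrArg TObj.Hom.shift (e.comm ⟨1, h1⟩ M (one_dvd _))
  simp only [TObj.comp_shift] at hc
  rw [jSeq_eq, jSeq_eq]
  have hm : ((M : ℕ+) : ℤ) ∣ (e.α M).hom.shift := (e.α M).hom.mem
  have : S'.jSeq h1 M - (S.jSeq h1 M + (e.α ⟨1, h1⟩).hom.shift) = -(e.α M).hom.shift := by
    rw [jSeq_eq, jSeq_eq]; linarith
  rw [jSeq_eq, jSeq_eq] at this
  rw [this, dvd_neg]
  exact hm

/-! ### Proposition 2.15 (iv): piecewise non-rigid `E`-systems II -/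

/-- A compatible family of integers that is NOT congruent to any integer constant: writing
`M = 2^a · m` with `m` odd, `twoAdicOne M := m ^ (2^a)`, which is `≡ 1 (mod 2^a)` (Euler) and
`≡ 0 (mod m)` — the element "`1` at `2`, `0` away from `2`" of `Ẑ = ℤ₂ × ∏_{p odd} ℤ_p`.
Used for Prop 2.15 (iv). [cite: MochizukiEtTh2009, Prop 2.15(iv) p.53] -/
def twoAdicOne (M : ℕ+) : ℤ :=
  ((((M : ℕ) / 2 ^ (M : ℕ).factorization 2) ^ (2 ^ (M : ℕ).factorization 2) : ℕ) : ℤ)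

/-- `2^{v₂(M)} ∣ twoAdicOne M - 1`. [cite: MochizukiEtTh2009, Prop 2.15(iv) p.53] -/
theorem ordProj_dvd_twoAdicOne_sub_one (M : ℕ+) :
    (((2 ^ (M : ℕ).factorization 2) : ℕ) : ℤ) ∣ twoAdicOne M - 1 := by
  have hM : (M : ℕ) ≠ 0 := PNat.ne_zero M
  have hcop0 : Nat.Coprime 2 ((M : ℕ) / 2 ^ (M : ℕ).factorization 2) :=
    Nat.coprime_ordCompl Nat.prime_two hM
  unfold twoAdicOne
  generalize (M : ℕ) / 2 ^ (M : ℕ).factorization 2 = m at hcop0 ⊢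
  generalize (M : ℕ).factorization 2 = a
  rcases Nat.eq_zero_or_pos a with h0 | hpos
  · subst h0; simp
  · have hcop : Nat.Coprime m (2 ^ a) := Nat.Coprime.pow_right a hcop0.symm
    have heul := Nat.ModEq.pow_totient hcop
    have hφ : Nat.totient (2 ^ a) = 2 ^ (a - 1) := by
      rw [Nat.totient_prime_pow Nat.prime_two hpos]; simp
    have h2a : 2 ^ a = Nat.totient (2 ^ a) * 2 := by
      rw [hφ, ← pow_succ]; congr 1; omega
    have hsq : m ^ (2 ^ a) ≡ 1 [MOD 2 ^ a] := by
      have := heul.pow 2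
      rw [← pow_mul, ← h2a, one_pow] at this
      exact this
    have := Nat.modEq_iff_dvd.mp hsq.symm
    push_cast at this ⊢
    exact this

/-- `m ∣ twoAdicOne M` for the odd part `m` of `M`. [cite: MochizukiEtTh2009, Prop 2.15(iv) p.53] -/
theorem ordCompl_dvd_twoAdicOne (M : ℕ+) :
    ((((M : ℕ) / 2 ^ (M : ℕ).factorization 2) : ℕ) : ℤ) ∣ twoAdicOne M := by
  simp only [twoAdicOne, Nat.cast_pow]
  exact dvd_pow_self _ (Nat.ordProj_pos _ _).ne'

/-- The family `twoAdicOne` is compatible: `M ∣ twoAdicOne M' - twoAdicOne M` for `M ∣ M'`.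
[cite: MochizukiEtTh2009, Prop 2.15(iv) p.53] -/
theorem twoAdicOne_compatible (M M' : ℕ+) (h : (M : ℕ+) ∣ M') :
    ((M : ℕ+) : ℤ) ∣ twoAdicOne M' - twoAdicOne M := by
  have hM : (M : ℕ) ≠ 0 := PNat.ne_zero M
  have hM' : (M' : ℕ) ≠ 0 := PNat.ne_zero M'
  have hnat : (M : ℕ) ∣ (M' : ℕ) := PNat.dvd_iff.mp h
  -- the 2-part
  have h2 : (((2 ^ (M : ℕ).factorization 2) : ℕ) : ℤ) ∣ twoAdicOne M' - twoAdicOne M := by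
    have e1 := ordProj_dvd_twoAdicOne_sub_one M
    have e2 : (((2 ^ (M : ℕ).factorization 2) : ℕ) : ℤ) ∣ twoAdicOne M' - 1 :=
      (Int.natCast_dvd_natCast.mpr (Nat.ordProj_dvd_ordProj_of_dvd hM' hnat 2)).trans
        (ordProj_dvd_twoAdicOne_sub_one M')
    have := dvd_sub e2 e1
    simpa using this
  -- the odd part
  have hodd : ((((M : ℕ) / 2 ^ (M : ℕ).factorization 2) : ℕ) : ℤ) ∣ twoAdicOne M' - twoAdicOne M := by
    refine dvd_sub ?_ (ordCompl_dvd_twoAdicOne M)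
    exact (Int.natCast_dvd_natCast.mpr (Nat.ordCompl_dvd_ordCompl_of_dvd hnat 2)).trans
      (ordCompl_dvd_twoAdicOne M')
  have hcop : IsCoprime (((2 ^ (M : ℕ).factorization 2) : ℕ) : ℤ) ((((M : ℕ) / 2 ^ (M : ℕ).factorization 2) : ℕ) : ℤ) :=
    Nat.isCoprime_iff_coprime.mpr
      (Nat.Coprime.pow_left _ (Nat.coprime_ordCompl Nat.prime_two hM))
  have := hcop.mul_dvd h2 hodd
  rwa [← Nat.cast_mul, Nat.ordProj_mul_ordCompl_eq_self] at this

/-- `twoAdicOne M` is odd whenever `M` is even... in fact always: it is a power of an odd number.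
[cite: MochizukiEtTh2009, Prop 2.15(iv) p.53] -/
theorem odd_twoAdicOne (M : ℕ+) : Odd (twoAdicOne M) := by
  have hM : (M : ℕ) ≠ 0 := PNat.ne_zero M
  have hodd : Odd (((M : ℕ) / 2 ^ (M : ℕ).factorization 2)) :=
    Nat.coprime_two_left.mp (Nat.coprime_ordCompl Nat.prime_two hM)
  simp only [twoAdicOne, Nat.cast_pow]
  exact hodd.natCast.pow

/-- No integer is congruent to `twoAdicOne M` modulo every `M` in a cofinal `E`.
[cite: MochizukiEtTh2009, Prop 2.15(iv) p.53] -/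
theorem twoAdicOne_not_integral (hcof : ∀ n : ℕ+, ∃ M ∈ E, n ∣ M) (n : ℤ) :
    ∃ M ∈ E, ¬ ((M : ℕ+) : ℤ) ∣ twoAdicOne M - n := by
  -- an odd modulus `q > |n|`, and `M ∈ E` divisible by `2q`
  set q : ℕ := 2 * n.natAbs + 1 with hq
  have hqpos : 0 < 2 * q := by omega
  obtain ⟨M, hME, hdiv⟩ := hcof ⟨2 * q, hqpos⟩
  refine ⟨M, hME, fun hd => ?_⟩
  have hM : (M : ℕ) ≠ 0 := PNat.ne_zero M
  have h2q : 2 * q ∣ (M : ℕ) := PNat.dvd_iff.mp hdiv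
  -- `q ∣ m := ordCompl[2] M`
  have hqodd : Nat.Coprime q ((2 ^ (M : ℕ).factorization 2)) := by
    refine Nat.Coprime.pow_right _ ?_
    rw [hq, Nat.coprime_comm, Nat.coprime_two_left]
    exact ⟨n.natAbs, rfl⟩
  have hqm : q ∣ ((M : ℕ) / 2 ^ (M : ℕ).factorization 2) := by
    have : q ∣ (2 ^ (M : ℕ).factorization 2) * ((M : ℕ) / 2 ^ (M : ℕ).factorization 2) := by
      rw [Nat.ordProj_mul_ordCompl_eq_self]; exact (Dvd.intro_left 2 rfl).trans h2q
    exact hqodd.dvd_of_dvd_mul_left this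
  have hqj : (q : ℤ) ∣ twoAdicOne M :=
    (Int.natCast_dvd_natCast.mpr hqm).trans (ordCompl_dvd_twoAdicOne M)
  have hqM : (q : ℤ) ∣ ((M : ℕ+) : ℤ) := by
    exact_mod_cast (Dvd.intro_left 2 rfl).trans h2q
  have hqn : (q : ℤ) ∣ n := by
    have := dvd_sub hqj (hqM.trans hd)
    simpa using this
  have hn0 : n = 0 := by
    refine Int.eq_zero_of_dvd_of_natAbs_lt_natAbs hqn ?_
    rw [Int.natAbs_natCast, hq]; omega
  subst hn0
  have h2M : (2 : ℤ) ∣ ((M : ℕ+) : ℤ) := by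
    exact_mod_cast (Dvd.intro _ rfl).trans h2q
  have : (2 : ℤ) ∣ twoAdicOne M := by simpa using h2M.trans hd
  exact (Int.not_even_iff_odd.mpr (odd_twoAdicOne M)) (even_iff_two_dvd.mpr this)

/-- **Proposition 2.15 (iv)** (Piecewise Non-rigid `E`-systems II): for `E` cofinal in
`(ℕ≥1, ∣)` with `1 ∈ E`, there exist non-isomorphic `E`-systems with `S_M = S'_M = T_M`.
[cite: MochizukiEtTh2009, Prop 2.15(iv) p.53] -/
theorem exists_nonisomorphic (h1 : (1 : ℕ+) ∈ E) (hcof : ∀ n : ℕ+, ∃ M ∈ E, n ∣ M) :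
    ∃ S S' : ESystem E id, IsEmpty (Iso S S') := by
  refine ⟨ofSeq (fun _ => 0) (fun M M' _ => by simp),
    ofSeq (fun M => twoAdicOne M) (fun M M' h => twoAdicOne_compatible M M' h), ⟨fun e => ?_⟩⟩
  obtain ⟨n, hn⟩ := jSeq_iso_invariant h1 e
  obtain ⟨M, hME, hnot⟩ := twoAdicOne_not_integral hcof (n + twoAdicOne 1)
  apply hnot
  have := hn ⟨M, hME⟩
  simp only [jSeq_eq, ofSeq, sub_zero, zero_add] at this
  have e : twoAdicOne M - (n + twoAdicOne 1) = twoAdicOne M - twoAdicOne 1 - n := by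
    ring
  rw [e]
  exact this

end ESystem

end Literature.AnabelianGeometry.EtaleTheta
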